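import Summits.QuantumFields.YangMills.Theorems.AlphaInputsT3ACv3HLiftSmall
import Summits.QuantumFields.YangMills.Theorems.UnitScaleTiltHistoryTailOneSupplierWindow
import HarnessLib

/-!
# `AlphaInputsT3ACv3HLiftWindowKnit` — the (FL) `hLift` binder, **FINAL WINDOW KNIT**: the WINDOWED `hLift` binder of ★★ `innerFineLiftsT3_of_regionalLiftsWindow_le` (✓ p603716) —
# «for every `k + 1 ≤ K`, every admissible non-trivial level-`(k+1)` history `h`, every level-`k` datum `V` windowed by `ε_W(k) := 2L²·avgWindowFactor L·θ(K−k)` on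
# `plaqsIn k Ω_{k+1}(h)`, and `ε_W(k) ≤ ε_FL`: an exact `k`-fold lift `U` with constrained finest plaquettes `< B·ε_W(k)·(Lᵏ)⁻²`» — ASSEMBLED from its two halves: LEAD's ✓ `hLift_small`
# (`Lᵏ < 16`: the section, no Newton, no smallness) and a DISPLAYED big-k clause `hBig` (`16 ≤ Lᵏ`: the START + Newton theorem of M22, concluding `≤ B_big·ε′∕(Lᵏ)²` under
# `0 < ε′ ≤ ε_FL`), at `B := max (B_big + 1) 257` — lane `pub-balaban3d` ∕ cell `ym3-torus`, width seat `ym-ust-19936-w2` (g3)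

WHY (★★OWNER ym3-torus-plan g26 ACK 3, 2026-08-28T04:45:53Z: «NEXT after (S6) = (o1) FINAL window knit `hLift_window_of_clauses` (✓`hLift_small` ⊕ ★w4's big-k clause ⟹ the WINDOWED
`hLift` binder of `…OneSupplierWindow.innerFineLiftsT3_of_regionalLiftsWindow_le` at `B_L := max(B_small, B_big)`)»).  The one-supplier theorems of record
(`historyTailL_of_thm1In8_regionalLiftsWindow_rows_allL`, `pinnedPartsT3ACRecFLChi_of_thm1_regionalLiftsWindow_rows`) read (FL) as that windowed binder inside the per-family
conjunct `∃ B_L ε_FL, 1 ≤ B_L ∧ B_L·L² ≤ B₃ ∧ avgWindowFactor L ≤ 8·B₃·Z_full·ε_FL ∧ ∀ γ K, …`; the M22 assembly (★w4-19936 g3 `hLift_clause_of_start` ∘ LEAD ★w1 g2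
`startT3_cert_omega` ∘ (H) `exists_exact_lift_regional_window_kfree`) delivers the `∃ U` clause for ONE `(k, h, V)` with `16 ≤ Lᵏ` in the shape `≤ B_big·(ε′∕(Lᵏ)²)`.  THIS FILE is
the bookkeeping between the two, once, against an ABSTRACT big-k clause (no dependence on the M22 file): the case split on `Lᵏ < 16`, the torus-size row `4Lᵏ ≤ N₀ = 2L^{m+K}`
DISCHARGED from `k + 1 ≤ K` and `1 ≤ m`, the positivity `0 < ε_W(k)` (`θBal_pos`, `b₀ > 0`, `γ ≤ 1`), and `≤ B_big·ε∕(Lᵏ)² < (B_big+1)·ε·((Lᵏ)⁻¹)²`.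
WHAT (def-free).  §1 `epsW_pos`, `four_mul_pow_le_sitesPerDir`; §2 ★★ `hLift_window_of_clauses` (the windowed binder VERBATIM from `hBig` concluding `≤ B_big·(ε′∕(Lᵏ)²)`, at `B := max (B_big+1) 257`) and ★★ `hLift_window_of_clauses_lt` (the same from `hBig` concluding in the binder's own shape `< B_big·ε′·((Lᵏ)⁻¹)²`, at `B := max B_big 257`); §3 ★ `innerFineLiftsT3_of_clauses`
(`InnerFineLiftsT3 F 𝔠 γ hγ hγ1 K 𝔠.B₃` from `hBig` + `max (B_big+1) 257 · L² ≤ B₃` + the record row); §4 ★ `flConjunct_of_clauses` (the per-family (FL) conjunct of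
`pinnedPartsT3ACRecFLChi_of_thm1_regionalLiftsWindow_rows` ∕ `…RecFL_…` for a family `F` and constants `𝔠 : AlphaConsts F.L _`, from `hBig` at every `(γ, K)` + the two rows).
HONEST FRAMING.  Composition only: the big-k clause `hBig` (START + Newton, M22) is a HYPOTHESIS here, not proved; (FL)∕`hLift`, the stub `stub_laneRecordsV3Chi`, the crux
`HistoryTailL` and any gap are NOT claimed; count-neutral helper toward R3 2′∕2′χ (items 19936∕19935, `--supports stmt-QuantumFields-19936`); registry untouched.  YM₃ on the
three-torus is rung R3 of the programme, not the Clay problem: nothing here is about d = 4, infinite volume, or a mass gap.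

References: T. Bałaban, Commun. Math. Phys. 102 (1985) 277–309 [Balaban1985Variational] (Thm 1 (8) p.279, (11)–(15) pp.279–280); Commun. Math. Phys. 102 (1985) 255–275
[Balaban1985UV3] ((7) p.257, (38)–(42) p.266, (45) p.267).
-/

set_option autoImplicit false

noncomputable section

namespace Summit.QuantumFields.YangMills.Theorems.HLiftWindowKnit

open scoped Matrix.Norms.L2Operator
open Literature.MathematicalPhysics.QuantumFieldTheory.Balaban1983to89
open Literature.MathematicalPhysics.QuantumFieldTheory.Balaban1983to89.T3ContinuumYM3Torus
open Literature.MathematicalPhysics.QuantumFieldTheory.Balaban1983to89.T3UnitLawDensityEML (ℰp)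
open Literature.MathematicalPhysics.QuantumFieldTheory.Balaban1983to89.T3UnitScaleTilt (θBal)
open Literature.MathematicalPhysics.QuantumFieldTheory.Balaban1983to89.B10Eq38TorusDomains (plaqsIn)
open Literature.MathematicalPhysics.QuantumFieldTheory.Balaban1983to89.B10Eq42TorusConstraint (bondsIn)
open Literature.MathematicalPhysics.QuantumFieldTheory.Balaban1985CMP102.Setting
open Summit.QuantumFields.Balaban3D.Carriers
open Summit.QuantumFields.Balaban3D.Proofs.Primitives (AlphaConsts)
open Summit.QuantumFields.YangMills.Theorems.HistoryTailOneSupplier (innerFineLiftsT3_of_regionalLiftsWindow_le)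

variable {F : T3Family} {𝔠 : AlphaConsts F.L (suGroupModel 2).N} {γ : ℝ} {hγ : 0 < γ} {hγ1 : γ ≤ (min 𝔠.gamma0 1) ^ 2} {K : ℕ}

/-! ## §1 Two rows discharged once: the window is positive; `4Lᵏ ≤ N₀` below the top -/

/-- **THE WINDOW IS POSITIVE**: `0 < ε_W(k) = 2L²·avgWindowFactor L·θ(K−k)` (`θ > 0` by `θBal_pos` from `b₀ > 0`, `0 < γ ≤ 1`, `L ≥ 1`). [cite: Balaban1985UV3, (7) p.257] -/
theorem epsW_pos (𝔠' : AlphaConsts F.L (suGroupModel 2).N) {γ' : ℝ} (hγ' : 0 < γ') (hγ1' : γ' ≤ (min 𝔠'.gamma0 1) ^ 2) (K' k : ℕ) :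
    0 < 2 * (F.L : ℝ) ^ 2 * avgWindowFactor F.L * θBal F.L γ' 𝔠'.b₀ 𝔠'.p₀ (K' - k) := by
  have hL1 : 1 ≤ F.L := F.hL.2.le
  have hL : (0 : ℝ) < (F.L : ℝ) := by exact_mod_cast (zero_lt_one.trans F.hL.2)
  have hA : 0 < avgWindowFactor F.L := by
    unfold avgWindowFactor
    have h1 : (0 : ℝ) < (F.L : ℝ) ^ 2 := pow_pos hL 2
    have h2 : (0 : ℝ) ≤ 6 * ((((3 + 2) * F.L : ℕ) : ℝ)) ^ 2 := by positivity
    linarith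
  have hθ := T3MinimiserStabilityReduction.θBal_pos hL1 hγ' (hγ1'.trans (sq_min_one_le _ 𝔠'.gamma0_pos)) 𝔠'.b₀_pos 𝔠'.p₀ (K' - k)
  positivity

/-- **`4·Lᵏ ≤ N₀` BELOW THE TOP**: for `k + 1 ≤ K` the finest torus has `N₀ = 2·L^{m+K} ≥ 2·L^{k+2} ≥ 4·Lᵏ` sites per direction (`1 ≤ m`, `L ≥ 2`). [folklore] -/
theorem four_mul_pow_le_sitesPerDir {k : ℕ} (hk : k + 1 ≤ K) : 4 * (F.P K).L ^ k ≤ (F.P K).sitesPerDir 0 := by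
  have hm : 1 ≤ (F.P K).m := F.hm
  have hL2 : 2 ≤ (F.P K).L := F.hL.2
  show 4 * (F.P K).L ^ k ≤ 2 * (F.P K).L ^ ((F.P K).m + (F.P K).K - 0)
  have hK : (F.P K).K = K := rfl
  rw [hK, Nat.sub_zero]
  have hexp : k + 2 ≤ (F.P K).m + K := by omega
  have h4 : 4 ≤ (F.P K).L ^ 2 := by nlinarith
  calc 4 * (F.P K).L ^ k ≤ (F.P K).L ^ 2 * (F.P K).L ^ k := Nat.mul_le_mul_right _ h4
    _ ≤ 2 * ((F.P K).L ^ 2 * (F.P K).L ^ k) := by omega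
    _ = 2 * (F.P K).L ^ (k + 2) := by rw [← pow_add, add_comm]
    _ ≤ 2 * (F.P K).L ^ ((F.P K).m + K) := Nat.mul_le_mul_left 2 (Nat.pow_le_pow_right (by omega) hexp)

/-! ## §2 The windowed `hLift` binder from the two clauses -/

variable (F 𝔠 γ hγ hγ1 K) in
/-- **★★ THE WINDOWED `hLift` BINDER FROM ITS TWO HALVES.**  HYPOTHESIS `hBig` (DISPLAYED — the M22 big-k clause, START + Newton; not proved here): for `k + 1 ≤ K` with `16 ≤ Lᵏ`
and `4Lᵏ ≤ N₀`, every admissible non-trivial level-`(k+1)` history `h`, every level-`k` field `V` and every `0 < ε′ ≤ ε_FL` windowing `V` on `plaqsIn k Ω_{k+1}(h)`, an exact `k`-fold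
lift with constrained finest plaquettes `≤ B_big·(ε′∕(Lᵏ)²)`.  CONCLUSION: the `hLift` hypothesis of ★★ `innerFineLiftsT3_of_regionalLiftsWindow_le` VERBATIM at
`B := max (B_big + 1) 257`, `ε_FL` — small `k` (`Lᵏ < 16`) by ✓ `TubeStart.hLift_small` (`B > 256`, window positive by `epsW_pos`), big `k` by `hBig` (`4Lᵏ ≤ N₀` by
`four_mul_pow_le_sitesPerDir`; `≤ B_big·ε∕(Lᵏ)² < (B_big+1)·ε·((Lᵏ)⁻¹)²`). [cite: Balaban1985Variational, Thm 1 (8) p.279, (11)–(15) pp.279–280; Balaban1985UV3, (38)–(42) p.266] -/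
theorem hLift_window_of_clauses {Bbig εFL : ℝ}
    (hBig : ∀ (k : ℕ), k + 1 ≤ K → 16 ≤ (F.P K).L ^ k → 4 * (F.P K).L ^ k ≤ (F.P K).sitesPerDir 0 → ∀ (h : Hist (F.P K) (k + 1)),
      Hist.Admissible 𝔠.lane.carrier.M₁ (rcolOf (T3Scales F γ hγ (hγ1.trans (sq_min_one_le _ 𝔠.gamma0_pos)) K) 𝔠.lane.carrier) (k + 1) h →
      h ≠ Hist.triv (F.P K) (k + 1) → ∀ (V : GaugeField (F.P K) k (Matrix.specialUnitaryGroup (Fin 2) ℂ)) (ε' : ℝ), 0 < ε' → ε' ≤ εFL →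
        (∀ Q : Plaq (F.P K) k, Q ∈ plaqsIn k (Omega 𝔠.lane.carrier.M₁
            (rcolOf (T3Scales F γ hγ (hγ1.trans (sq_min_one_le _ 𝔠.gamma0_pos)) K) 𝔠.lane.carrier) (k + 1) h (k + 1)) →
          GaugeGroup.dist1 (GaugeField.plaqHol V Q) ≤ ε') →
        ∃ U : GaugeField (F.P K) 0 (Matrix.specialUnitaryGroup (Fin 2) ℂ),
          (∀ b : PBond (F.P K) k, b ∈ bondsIn k (Omega 𝔠.lane.carrier.M₁
              (rcolOf (T3Scales F γ hγ (hγ1.trans (sq_min_one_le _ 𝔠.gamma0_pos)) K) 𝔠.lane.carrier) (k + 1) h (k + 1)) →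
            Averaging.iter (fun i => BlockAveraging.blockAvg (P := F.P K) (j := i) ℰp) k U b = V b) ∧
          ∀ q : Plaq (F.P K) 0, q ∈ plaqsIn 0 (Omega 𝔠.lane.carrier.M₁
              (rcolOf (T3Scales F γ hγ (hγ1.trans (sq_min_one_le _ 𝔠.gamma0_pos)) K) 𝔠.lane.carrier) (k + 1) h (k + 1)) →
            GaugeGroup.dist1 (GaugeField.plaqHol U q) ≤ Bbig * (ε' / (((F.P K).L : ℝ) ^ k) ^ 2)) :
    ∀ (k : ℕ), k + 1 ≤ K → ∀ (h : Hist (F.P K) (k + 1)),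
      Hist.Admissible 𝔠.lane.carrier.M₁ (rcolOf (T3Scales F γ hγ (hγ1.trans (sq_min_one_le _ 𝔠.gamma0_pos)) K) 𝔠.lane.carrier) (k + 1) h →
      h ≠ Hist.triv (F.P K) (k + 1) → ∀ (V : GaugeField (F.P K) k (Matrix.specialUnitaryGroup (Fin 2) ℂ)),
        (∀ Q : Plaq (F.P K) k, Q ∈ plaqsIn k (Omega 𝔠.lane.carrier.M₁
            (rcolOf (T3Scales F γ hγ (hγ1.trans (sq_min_one_le _ 𝔠.gamma0_pos)) K) 𝔠.lane.carrier) (k + 1) h (k + 1)) →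
          GaugeGroup.dist1 (GaugeField.plaqHol V Q) ≤ 2 * (F.L : ℝ) ^ 2 * avgWindowFactor F.L * θBal F.L γ 𝔠.b₀ 𝔠.p₀ (K - k)) →
        2 * (F.L : ℝ) ^ 2 * avgWindowFactor F.L * θBal F.L γ 𝔠.b₀ 𝔠.p₀ (K - k) ≤ εFL →
        ∃ U : GaugeField (F.P K) 0 (Matrix.specialUnitaryGroup (Fin 2) ℂ),
          (∀ b : PBond (F.P K) k, b ∈ bondsIn k (Omega 𝔠.lane.carrier.M₁
              (rcolOf (T3Scales F γ hγ (hγ1.trans (sq_min_one_le _ 𝔠.gamma0_pos)) K) 𝔠.lane.carrier) (k + 1) h (k + 1)) →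
            Averaging.iter (fun i => BlockAveraging.blockAvg (P := F.P K) (j := i) ℰp) k U b = V b) ∧
          ∀ q : Plaq (F.P K) 0, q ∈ plaqsIn 0 (Omega 𝔠.lane.carrier.M₁
              (rcolOf (T3Scales F γ hγ (hγ1.trans (sq_min_one_le _ 𝔠.gamma0_pos)) K) 𝔠.lane.carrier) (k + 1) h (k + 1)) →
            GaugeGroup.dist1 (GaugeField.plaqHol U q) <
              max (Bbig + 1) 257 * (2 * (F.L : ℝ) ^ 2 * avgWindowFactor F.L * θBal F.L γ 𝔠.b₀ 𝔠.p₀ (K - k)) * (((F.L : ℝ) ^ k)⁻¹) ^ 2 := by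
  intro k hk h hadm hnt V hV hwin
  set ε : ℝ := 2 * (F.L : ℝ) ^ 2 * avgWindowFactor F.L * θBal F.L γ 𝔠.b₀ 𝔠.p₀ (K - k) with hε
  have hεpos : 0 < ε := epsW_pos 𝔠 hγ hγ1 K k
  have hPL : ((F.P K).L : ℝ) = (F.L : ℝ) := rfl
  have hL : (0 : ℝ) < (F.L : ℝ) := by exact_mod_cast (zero_lt_one.trans F.hL.2)
  have hLk : (0 : ℝ) < (F.L : ℝ) ^ k := pow_pos hL k
  by_cases hsmall : (F.P K).L ^ k < 16
  · -- small `k`: the section (LEAD's `hLift_small`), any `B > 256`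
    have hkm : k ≤ (F.P K).m + (F.P K).K := by
      show k ≤ F.m + K
      omega
    obtain ⟨U, hUavg, hUreg⟩ := TubeStart.hLift_small (n := Fin 2) 𝔠.lane.carrier.M₁
      (rcolOf (T3Scales F γ hγ (hγ1.trans (sq_min_one_le _ 𝔠.gamma0_pos)) K) 𝔠.lane.carrier) hkm hsmall h hεpos
      (B := max (Bbig + 1) 257) (lt_of_lt_of_le (by norm_num) (le_max_right _ _)) V hV
    refine ⟨U, hUavg, fun q hq => ?_⟩
    have := hUreg q hq
    rwa [hPL] at this
  · -- big `k`: the displayed START + Newton clause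
    have h16 : 16 ≤ (F.P K).L ^ k := not_lt.mp hsmall
    obtain ⟨U, hUavg, hUreg⟩ := hBig k hk h16 (four_mul_pow_le_sitesPerDir hk) h hadm hnt V ε hεpos hwin hV
    refine ⟨U, hUavg, fun q hq => ?_⟩
    have h1 := hUreg q hq
    rw [hPL] at h1
    have hB1 : Bbig + 1 ≤ max (Bbig + 1) 257 := le_max_left _ _
    have hq2 : (0 : ℝ) < ε * (((F.L : ℝ) ^ k)⁻¹) ^ 2 := by positivity
    calc GaugeGroup.dist1 (GaugeField.plaqHol U q) ≤ Bbig * (ε / ((F.L : ℝ) ^ k) ^ 2) := h1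
      _ = Bbig * (ε * (((F.L : ℝ) ^ k)⁻¹) ^ 2) := by rw [div_eq_mul_inv, inv_pow]
      _ < (Bbig + 1) * (ε * (((F.L : ℝ) ^ k)⁻¹) ^ 2) := by nlinarith
      _ ≤ max (Bbig + 1) 257 * (ε * (((F.L : ℝ) ^ k)⁻¹) ^ 2) := mul_le_mul_of_nonneg_right hB1 hq2.le
      _ = max (Bbig + 1) 257 * ε * (((F.L : ℝ) ^ k)⁻¹) ^ 2 := by ring

variable (F 𝔠 γ hγ hγ1 K) in
/-- **★★ THE WINDOWED `hLift` BINDER FROM ITS TWO HALVES — big-k clause in the BINDER'S OWN `<`-SHAPE**: same as `hLift_window_of_clauses` but with `hBig` concluding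
`dist1 U(∂q) < B_big·ε′·((Lᵏ)⁻¹)²` (the shape of the `hLift` binder itself, `(F.L : ℝ) ^ k`); conclusion at `B := max B_big 257`.
[cite: Balaban1985Variational, Thm 1 (8) p.279, (11)–(15) pp.279–280; Balaban1985UV3, (38)–(42) p.266] -/
theorem hLift_window_of_clauses_lt {Bbig εFL : ℝ}
    (hBig : ∀ (k : ℕ), k + 1 ≤ K → 16 ≤ (F.P K).L ^ k → 4 * (F.P K).L ^ k ≤ (F.P K).sitesPerDir 0 → ∀ (h : Hist (F.P K) (k + 1)),
      Hist.Admissible 𝔠.lane.carrier.M₁ (rcolOf (T3Scales F γ hγ (hγ1.trans (sq_min_one_le _ 𝔠.gamma0_pos)) K) 𝔠.lane.carrier) (k + 1) h →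
      h ≠ Hist.triv (F.P K) (k + 1) → ∀ (V : GaugeField (F.P K) k (Matrix.specialUnitaryGroup (Fin 2) ℂ)) (ε' : ℝ), 0 < ε' → ε' ≤ εFL →
        (∀ Q : Plaq (F.P K) k, Q ∈ plaqsIn k (Omega 𝔠.lane.carrier.M₁
            (rcolOf (T3Scales F γ hγ (hγ1.trans (sq_min_one_le _ 𝔠.gamma0_pos)) K) 𝔠.lane.carrier) (k + 1) h (k + 1)) →
          GaugeGroup.dist1 (GaugeField.plaqHol V Q) ≤ ε') →
        ∃ U : GaugeField (F.P K) 0 (Matrix.specialUnitaryGroup (Fin 2) ℂ),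
          (∀ b : PBond (F.P K) k, b ∈ bondsIn k (Omega 𝔠.lane.carrier.M₁
              (rcolOf (T3Scales F γ hγ (hγ1.trans (sq_min_one_le _ 𝔠.gamma0_pos)) K) 𝔠.lane.carrier) (k + 1) h (k + 1)) →
            Averaging.iter (fun i => BlockAveraging.blockAvg (P := F.P K) (j := i) ℰp) k U b = V b) ∧
          ∀ q : Plaq (F.P K) 0, q ∈ plaqsIn 0 (Omega 𝔠.lane.carrier.M₁
              (rcolOf (T3Scales F γ hγ (hγ1.trans (sq_min_one_le _ 𝔠.gamma0_pos)) K) 𝔠.lane.carrier) (k + 1) h (k + 1)) →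
            GaugeGroup.dist1 (GaugeField.plaqHol U q) < Bbig * ε' * (((F.L : ℝ) ^ k)⁻¹) ^ 2) :
    ∀ (k : ℕ), k + 1 ≤ K → ∀ (h : Hist (F.P K) (k + 1)),
      Hist.Admissible 𝔠.lane.carrier.M₁ (rcolOf (T3Scales F γ hγ (hγ1.trans (sq_min_one_le _ 𝔠.gamma0_pos)) K) 𝔠.lane.carrier) (k + 1) h →
      h ≠ Hist.triv (F.P K) (k + 1) → ∀ (V : GaugeField (F.P K) k (Matrix.specialUnitaryGroup (Fin 2) ℂ)),
        (∀ Q : Plaq (F.P K) k, Q ∈ plaqsIn k (Omega 𝔠.lane.carrier.M₁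
            (rcolOf (T3Scales F γ hγ (hγ1.trans (sq_min_one_le _ 𝔠.gamma0_pos)) K) 𝔠.lane.carrier) (k + 1) h (k + 1)) →
          GaugeGroup.dist1 (GaugeField.plaqHol V Q) ≤ 2 * (F.L : ℝ) ^ 2 * avgWindowFactor F.L * θBal F.L γ 𝔠.b₀ 𝔠.p₀ (K - k)) →
        2 * (F.L : ℝ) ^ 2 * avgWindowFactor F.L * θBal F.L γ 𝔠.b₀ 𝔠.p₀ (K - k) ≤ εFL →
        ∃ U : GaugeField (F.P K) 0 (Matrix.specialUnitaryGroup (Fin 2) ℂ),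
          (∀ b : PBond (F.P K) k, b ∈ bondsIn k (Omega 𝔠.lane.carrier.M₁
              (rcolOf (T3Scales F γ hγ (hγ1.trans (sq_min_one_le _ 𝔠.gamma0_pos)) K) 𝔠.lane.carrier) (k + 1) h (k + 1)) →
            Averaging.iter (fun i => BlockAveraging.blockAvg (P := F.P K) (j := i) ℰp) k U b = V b) ∧
          ∀ q : Plaq (F.P K) 0, q ∈ plaqsIn 0 (Omega 𝔠.lane.carrier.M₁
              (rcolOf (T3Scales F γ hγ (hγ1.trans (sq_min_one_le _ 𝔠.gamma0_pos)) K) 𝔠.lane.carrier) (k + 1) h (k + 1)) →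
            GaugeGroup.dist1 (GaugeField.plaqHol U q) <
              max Bbig 257 * (2 * (F.L : ℝ) ^ 2 * avgWindowFactor F.L * θBal F.L γ 𝔠.b₀ 𝔠.p₀ (K - k)) * (((F.L : ℝ) ^ k)⁻¹) ^ 2 := by
  intro k hk h hadm hnt V hV hwin
  set ε : ℝ := 2 * (F.L : ℝ) ^ 2 * avgWindowFactor F.L * θBal F.L γ 𝔠.b₀ 𝔠.p₀ (K - k) with hε
  have hεpos : 0 < ε := epsW_pos 𝔠 hγ hγ1 K k
  have hPL : ((F.P K).L : ℝ) = (F.L : ℝ) := rfl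
  have hL : (0 : ℝ) < (F.L : ℝ) := by exact_mod_cast (zero_lt_one.trans F.hL.2)
  have hLk : (0 : ℝ) < (F.L : ℝ) ^ k := pow_pos hL k
  by_cases hsmall : (F.P K).L ^ k < 16
  · -- small `k`: the section (LEAD's `hLift_small`), any `B > 256`
    have hkm : k ≤ (F.P K).m + (F.P K).K := by
      show k ≤ F.m + K
      omega
    obtain ⟨U, hUavg, hUreg⟩ := TubeStart.hLift_small (n := Fin 2) 𝔠.lane.carrier.M₁
      (rcolOf (T3Scales F γ hγ (hγ1.trans (sq_min_one_le _ 𝔠.gamma0_pos)) K) 𝔠.lane.carrier) hkm hsmall h hεpos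
      (B := max Bbig 257) (lt_of_lt_of_le (by norm_num) (le_max_right _ _)) V hV
    refine ⟨U, hUavg, fun q hq => ?_⟩
    have := hUreg q hq
    rwa [hPL] at this
  · -- big `k`: the displayed START + Newton clause, already in the binder's shape
    have h16 : 16 ≤ (F.P K).L ^ k := not_lt.mp hsmall
    obtain ⟨U, hUavg, hUreg⟩ := hBig k hk h16 (four_mul_pow_le_sitesPerDir hk) h hadm hnt V ε hεpos hwin hV
    refine ⟨U, hUavg, fun q hq => ?_⟩
    have hq2 : (0 : ℝ) < ε * (((F.L : ℝ) ^ k)⁻¹) ^ 2 := by positivity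
    calc GaugeGroup.dist1 (GaugeField.plaqHol U q) < Bbig * ε * (((F.L : ℝ) ^ k)⁻¹) ^ 2 := hUreg q hq
      _ = Bbig * (ε * (((F.L : ℝ) ^ k)⁻¹) ^ 2) := by ring
      _ ≤ max Bbig 257 * (ε * (((F.L : ℝ) ^ k)⁻¹) ^ 2) := mul_le_mul_of_nonneg_right (le_max_left _ _) hq2.le
      _ = max Bbig 257 * ε * (((F.L : ℝ) ^ k)⁻¹) ^ 2 := by ring

/-! ## §3 (FL) at the record's constant from the two clauses -/

variable (F 𝔠 γ hγ hγ1 K) in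
/-- **★ (FL) AT THE RECORD'S `B₃` FROM THE TWO CLAUSES**: `hBig` (displayed, as in `hLift_window_of_clauses`) + `max (B_big+1) 257 · L² ≤ B₃` + the record row
`avgWindowFactor L ≤ 8·B₃·Z_full·ε_FL` give `InnerFineLiftsT3 F 𝔠 γ hγ hγ1 K 𝔠.B₃` (`hLift_window_of_clauses` ∘ `innerFineLiftsT3_of_regionalLiftsWindow_le`).
[cite: Balaban1985Variational, Thm 1 (8) p.279, (11)–(14) pp.279–280; Balaban1985UV3, (7) p.257, (40)+(42) p.266, (45) p.267] -/
theorem innerFineLiftsT3_of_clauses {Bbig εFL : ℝ} (hBB : max (Bbig + 1) 257 * (F.L : ℝ) ^ 2 ≤ 𝔠.B₃)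
    (hrow : avgWindowFactor F.L ≤ 8 * 𝔠.B₃ * 𝔠.Zfull * εFL)
    (hBig : ∀ (k : ℕ), k + 1 ≤ K → 16 ≤ (F.P K).L ^ k → 4 * (F.P K).L ^ k ≤ (F.P K).sitesPerDir 0 → ∀ (h : Hist (F.P K) (k + 1)),
      Hist.Admissible 𝔠.lane.carrier.M₁ (rcolOf (T3Scales F γ hγ (hγ1.trans (sq_min_one_le _ 𝔠.gamma0_pos)) K) 𝔠.lane.carrier) (k + 1) h →
      h ≠ Hist.triv (F.P K) (k + 1) → ∀ (V : GaugeField (F.P K) k (Matrix.specialUnitaryGroup (Fin 2) ℂ)) (ε' : ℝ), 0 < ε' → ε' ≤ εFL →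
        (∀ Q : Plaq (F.P K) k, Q ∈ plaqsIn k (Omega 𝔠.lane.carrier.M₁
            (rcolOf (T3Scales F γ hγ (hγ1.trans (sq_min_one_le _ 𝔠.gamma0_pos)) K) 𝔠.lane.carrier) (k + 1) h (k + 1)) →
          GaugeGroup.dist1 (GaugeField.plaqHol V Q) ≤ ε') →
        ∃ U : GaugeField (F.P K) 0 (Matrix.specialUnitaryGroup (Fin 2) ℂ),
          (∀ b : PBond (F.P K) k, b ∈ bondsIn k (Omega 𝔠.lane.carrier.M₁
              (rcolOf (T3Scales F γ hγ (hγ1.trans (sq_min_one_le _ 𝔠.gamma0_pos)) K) 𝔠.lane.carrier) (k + 1) h (k + 1)) →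
            Averaging.iter (fun i => BlockAveraging.blockAvg (P := F.P K) (j := i) ℰp) k U b = V b) ∧
          ∀ q : Plaq (F.P K) 0, q ∈ plaqsIn 0 (Omega 𝔠.lane.carrier.M₁
              (rcolOf (T3Scales F γ hγ (hγ1.trans (sq_min_one_le _ 𝔠.gamma0_pos)) K) 𝔠.lane.carrier) (k + 1) h (k + 1)) →
            GaugeGroup.dist1 (GaugeField.plaqHol U q) ≤ Bbig * (ε' / (((F.P K).L : ℝ) ^ k) ^ 2)) :
    AlphaInputsT3AC.InnerFineLiftsT3 F 𝔠 γ hγ hγ1 K 𝔠.B₃ :=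
  innerFineLiftsT3_of_regionalLiftsWindow_le (le_trans (by norm_num) (le_max_right (Bbig + 1) 257)) hBB hrow
    (hLift_window_of_clauses F 𝔠 γ hγ hγ1 K hBig)

/-! ## §4 The per-family (FL) conjunct of the one-supplier theorems from the two clauses -/

variable (F 𝔠) in
/-- **★ THE PER-FAMILY (FL) CONJUNCT OF THE ONE-SUPPLIER THEOREMS FROM THE TWO CLAUSES**: for a family `F` and constants `𝔠 : AlphaConsts F.L _` (the consumer's `hF ▸ 𝔠` after
`subst`), the big-k clause at EVERY coupling `γ` and run length `K` (displayed) + `max (B_big+1) 257 · L² ≤ B₃` + `avgWindowFactor L ≤ 8·B₃·Z_full·ε_FL` give the conjunct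
`∃ B_L ε_FL, 1 ≤ B_L ∧ B_L·L² ≤ B₃ ∧ avgWindowFactor L ≤ 8·B₃·Z_full·ε_FL ∧ ∀ γ hγ hγ1 K, «windowed hLift at (B_L, ε_FL)»` of ★★
`pinnedPartsT3ACRecFLChi_of_thm1_regionalLiftsWindow_rows` ∕ `pinnedPartsT3ACRecFL_of_thm1_regionalLiftsWindow_rows`, with `B_L := max (B_big+1) 257`.
[cite: Balaban1985Variational, Thm 1 (8) p.279, (11)–(14) pp.279–280; Balaban1985UV3, (7) p.257, (45)+(47) p.267] -/
theorem flConjunct_of_clauses {Bbig εFL : ℝ} (hBB : max (Bbig + 1) 257 * (F.L : ℝ) ^ 2 ≤ 𝔠.B₃)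
    (hrow : avgWindowFactor F.L ≤ 8 * 𝔠.B₃ * 𝔠.Zfull * εFL)
    (hBig : ∀ (γ : ℝ) (hγ : 0 < γ) (hγ1 : γ ≤ (min 𝔠.gamma0 1) ^ 2) (K : ℕ),
      ∀ (k : ℕ), k + 1 ≤ K → 16 ≤ (F.P K).L ^ k → 4 * (F.P K).L ^ k ≤ (F.P K).sitesPerDir 0 → ∀ (h : Hist (F.P K) (k + 1)),
      Hist.Admissible 𝔠.lane.carrier.M₁ (rcolOf (T3Scales F γ hγ (hγ1.trans (sq_min_one_le _ 𝔠.gamma0_pos)) K) 𝔠.lane.carrier) (k + 1) h →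
      h ≠ Hist.triv (F.P K) (k + 1) → ∀ (V : GaugeField (F.P K) k (Matrix.specialUnitaryGroup (Fin 2) ℂ)) (ε' : ℝ), 0 < ε' → ε' ≤ εFL →
        (∀ Q : Plaq (F.P K) k, Q ∈ plaqsIn k (Omega 𝔠.lane.carrier.M₁
            (rcolOf (T3Scales F γ hγ (hγ1.trans (sq_min_one_le _ 𝔠.gamma0_pos)) K) 𝔠.lane.carrier) (k + 1) h (k + 1)) →
          GaugeGroup.dist1 (GaugeField.plaqHol V Q) ≤ ε') →
        ∃ U : GaugeField (F.P K) 0 (Matrix.specialUnitaryGroup (Fin 2) ℂ),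
          (∀ b : PBond (F.P K) k, b ∈ bondsIn k (Omega 𝔠.lane.carrier.M₁
              (rcolOf (T3Scales F γ hγ (hγ1.trans (sq_min_one_le _ 𝔠.gamma0_pos)) K) 𝔠.lane.carrier) (k + 1) h (k + 1)) →
            Averaging.iter (fun i => BlockAveraging.blockAvg (P := F.P K) (j := i) ℰp) k U b = V b) ∧
          ∀ q : Plaq (F.P K) 0, q ∈ plaqsIn 0 (Omega 𝔠.lane.carrier.M₁
              (rcolOf (T3Scales F γ hγ (hγ1.trans (sq_min_one_le _ 𝔠.gamma0_pos)) K) 𝔠.lane.carrier) (k + 1) h (k + 1)) →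
            GaugeGroup.dist1 (GaugeField.plaqHol U q) ≤ Bbig * (ε' / (((F.P K).L : ℝ) ^ k) ^ 2)) :
    ∃ B_L εFL' : ℝ, 1 ≤ B_L ∧ B_L * (F.L : ℝ) ^ 2 ≤ 𝔠.B₃ ∧ avgWindowFactor F.L ≤ 8 * 𝔠.B₃ * 𝔠.Zfull * εFL' ∧
      ∀ (γ : ℝ) (hγ : 0 < γ) (hγ1 : γ ≤ (min 𝔠.gamma0 1) ^ 2) (K : ℕ),
      ∀ (k : ℕ), k + 1 ≤ K → ∀ (h : Hist (F.P K) (k + 1)),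
        Hist.Admissible 𝔠.lane.carrier.M₁ (rcolOf (T3Scales F γ hγ (hγ1.trans (sq_min_one_le _ 𝔠.gamma0_pos)) K) 𝔠.lane.carrier) (k + 1) h →
        h ≠ Hist.triv (F.P K) (k + 1) → ∀ (V : GaugeField (F.P K) k (Matrix.specialUnitaryGroup (Fin 2) ℂ)),
          (∀ Q : Plaq (F.P K) k, Q ∈ plaqsIn k (Omega 𝔠.lane.carrier.M₁
              (rcolOf (T3Scales F γ hγ (hγ1.trans (sq_min_one_le _ 𝔠.gamma0_pos)) K) 𝔠.lane.carrier) (k + 1) h (k + 1)) →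
            GaugeGroup.dist1 (GaugeField.plaqHol V Q) ≤ 2 * (F.L : ℝ) ^ 2 * avgWindowFactor F.L * θBal F.L γ 𝔠.b₀ 𝔠.p₀ (K - k)) →
          2 * (F.L : ℝ) ^ 2 * avgWindowFactor F.L * θBal F.L γ 𝔠.b₀ 𝔠.p₀ (K - k) ≤ εFL' →
          ∃ U : GaugeField (F.P K) 0 (Matrix.specialUnitaryGroup (Fin 2) ℂ),
            (∀ b : PBond (F.P K) k, b ∈ bondsIn k (Omega 𝔠.lane.carrier.M₁
                (rcolOf (T3Scales F γ hγ (hγ1.trans (sq_min_one_le _ 𝔠.gamma0_pos)) K) 𝔠.lane.carrier) (k + 1) h (k + 1)) →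
              Averaging.iter (fun i => BlockAveraging.blockAvg (P := F.P K) (j := i) ℰp) k U b = V b) ∧
            ∀ q : Plaq (F.P K) 0, q ∈ plaqsIn 0 (Omega 𝔠.lane.carrier.M₁
                (rcolOf (T3Scales F γ hγ (hγ1.trans (sq_min_one_le _ 𝔠.gamma0_pos)) K) 𝔠.lane.carrier) (k + 1) h (k + 1)) →
              GaugeGroup.dist1 (GaugeField.plaqHol U q) <
                B_L * (2 * (F.L : ℝ) ^ 2 * avgWindowFactor F.L * θBal F.L γ 𝔠.b₀ 𝔠.p₀ (K - k)) * (((F.L : ℝ) ^ k)⁻¹) ^ 2 :=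
  ⟨max (Bbig + 1) 257, εFL, le_trans (by norm_num) (le_max_right (Bbig + 1) 257), hBB, hrow,
    fun γ hγ hγ1 K => hLift_window_of_clauses F 𝔠 γ hγ hγ1 K (hBig γ hγ hγ1 K)⟩

end Summit.QuantumFields.YangMills.Theorems.HLiftWindowKnit

end
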